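import Literature.NumberTheory.PAdicHodge.TateAlmostEtaleIntegralBases
import HarnessLib

/-!
# Finite extensions of `ℚ_p` inside `F̄`: the value group is cyclic, and the ramification index
# divides the degree (toward the tame structure theorem and Tate's (TS1), Tate 1967 §3.2)

Notation of the tree's `PAdicHodge` files: `F` a non-archimedean local field of characteristic `0` and
residue characteristic `p`, `K₀ = PadicBase F p hp ≅ ℚ_p` (normed by `F`), `F̄ = NormedAlgClosure F`
(ultrametric, algebraically closed, Galois conjugates are isometric), `q = ‖p‖ < 1`. For an intermediate
field `K₀ ⊆ M ⊆ F̄` which is FINITE over `K₀` (an abstract `p`-adic field, read inside `F̄` with the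
absolute value of `F̄`) this file proves, from the absolute value alone (no residue fields, no
discrete valuation rings):

* `TateAlmostEtale.norm_algHom_base_apply`, `norm_algebraMap_norm_base_eq` : `K₀`-embeddings `M → F̄`
  are isometric, so `‖N_{M/K₀}(z)‖ = ‖z‖ ^ [M : K₀]`;
* `TateAlmostEtale.exists_norm_pow_finrank_eq_zpow` : `‖M^×‖ ^ [M:K₀] ⊆ ‖p‖^ℤ` — the value group of
  `M` lies in the cyclic group `‖p‖^{(1/[M:K₀]) ℤ}`;
* `TateAlmostEtale.exists_uniformizer` : **the value group of `M` is cyclic** — there is `ϖ ∈ M`,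
  `0 < ‖ϖ‖ < 1`, with `‖x‖ ∈ ‖ϖ‖^ℤ` for every `x ∈ M^×` (a uniformiser); consequences
  `norm_le_norm_uniformizer_of_norm_lt_one` (`‖x‖ < 1 ⇒ ‖x‖ ≤ ‖ϖ‖`: discreteness) and
  `exists_norm_eq_uniformizer_pow_of_norm_le_one`;
* `TateAlmostEtale.ramificationIndex_dvd_finrank` : **`e ∣ [M : B]`** — if `K₀ ⊆ B ⊆ M`, the value
  group of `B` is `‖π‖^ℤ` and `‖π‖ = ‖ϖ‖ ^ e`, then `e` divides `[M : B]` (`‖N_{M/B}(ϖ)‖ = ‖ϖ‖^{[M:B]}`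
  lies in `‖π‖^ℤ = ‖ϖ‖^{eℤ}`). In particular `p ∤ [M : B] ⇒ p ∤ e`.

These are the valuation-theoretic inputs of the structure theorem for tamely ramified extensions of
the cyclotomic field `K_∞` (`TateTameStructure`), the last step of the tree's elementary (Kummer) proof
of Tate's almost étale lemma (TS1). No `sorry`, no definitions.

References: J.-P. Serre, *Local Fields*, Ch. II §2–§3 (finite extensions of complete fields: `e f = n`,
uniformisers) [SerreLocalFields1979]; S. Lang, *Algebraic Number Theory*, Ch. II §4–§5
[LangANT1994]; J. Tate, *p-divisible groups* (1967) §3.2 [Tate1967].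
-/

noncomputable section

open Polynomial IntermediateField Module ValuativeRel Field

namespace Literature.NumberTheory.PAdicHodge

namespace TateAlmostEtale

open Literature.NumberTheory.GaloisRepresentations
open Literature.NumberTheory.GaloisRepresentations.IsNonarchimedeanLocalField

variable {F : Type} [Field F] [ValuativeRel F] [TopologicalSpace F] [IsNonarchimedeanLocalField F]
  [CharZero F] {p : ℕ} [Fact p.Prime] (hp : valuation F p < 1)

/-! ### §1 Norms from a finite extension of `K₀` inside `F̄` -/

section Norms

variable (M : IntermediateField (PadicBase F p hp) (NormedAlgClosure F))

/-- **`K₀`-embeddings are isometric**: for `K₀ ⊆ M ⊆ F̄` and a `K₀`-embedding `σ : M → F̄`,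
`‖σ z‖ = ‖z‖` (`σ z` is a `K₀`-conjugate of `z`, hence `g • z` for some `g ∈ G₀`, an isometry).
[cite: SerreLocalFields1979, Ch. II §2] [cite: Tate1967, §3.1] -/
theorem norm_algHom_base_apply (σ : M →ₐ[PadicBase F p hp] NormedAlgClosure F) (z : M) :
    ‖σ z‖ = ‖(z : NormedAlgClosure F)‖ := by
  have hint : IsIntegral (PadicBase F p hp) z := Algebra.IsIntegral.isIntegral z
  have hmin : minpoly (PadicBase F p hp) (z : NormedAlgClosure F) = minpoly (PadicBase F p hp) z :=
    minpoly.algHom_eq M.val Subtype.val_injective z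
  have hmem : σ z ∈ (minpoly (PadicBase F p hp) (z : NormedAlgClosure F)).aroots (NormedAlgClosure F) := by
    rw [mem_aroots, hmin]
    refine ⟨minpoly.ne_zero hint, ?_⟩
    rw [aeval_algHom_apply, minpoly.aeval, map_zero]
  exact BaseGaloisGroup.norm_eq_of_mem_aroots hp (z : NormedAlgClosure F) (σ z) hmem

variable [FiniteDimensional (PadicBase F p hp) M]

/-- **`‖N_{M/K₀}(z)‖ = ‖z‖ ^ [M : K₀]`**: the norm is the product of the (isometric) `K₀`-conjugates.
[cite: SerreLocalFields1979, Ch. II §2 Cor. 4] [cite: Tate1967, §3.1] -/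
theorem norm_algebraMap_norm_base_eq (z : M) :
    ‖algebraMap (PadicBase F p hp) (NormedAlgClosure F) (Algebra.norm (PadicBase F p hp) z)‖ =
      ‖(z : NormedAlgClosure F)‖ ^ finrank (PadicBase F p hp) M := by
  haveI : Algebra.IsSeparable (PadicBase F p hp) M := Algebra.IsAlgebraic.isSeparable_of_perfectField
  rw [Algebra.norm_eq_prod_embeddings (PadicBase F p hp) (NormedAlgClosure F) z, norm_prod,
    Finset.prod_congr rfl fun σ _ => norm_algHom_base_apply hp M σ z, Finset.prod_const,
    Finset.card_univ, AlgHom.card]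

/-- **The value group of a finite extension of `ℚ_p` lies in `‖p‖^{(1/n)ℤ}`**, `n = [M : K₀]`: for
`x ∈ M`, `x ≠ 0`, `‖x‖ ^ n = ‖p‖ ^ k` for some `k ∈ ℤ` (`‖N(x)‖ = ‖x‖^n` and `‖K₀^×‖ = ‖p‖^ℤ`).
[cite: SerreLocalFields1979, Ch. II §2] [cite: LangANT1994, Ch. II §4] -/
theorem exists_norm_pow_finrank_eq_zpow {x : NormedAlgClosure F} (hx : x ∈ M) (hx0 : x ≠ 0) :
    ∃ k : ℤ, ‖x‖ ^ finrank (PadicBase F p hp) M = ‖(p : NormedAlgClosure F)‖ ^ k := by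
  set z : M := ⟨x, hx⟩ with hz
  have hz0 : z ≠ 0 := fun h => hx0 (by rw [hz] at h; exact congrArg Subtype.val h)
  have hN0 : Algebra.norm (PadicBase F p hp) z ≠ 0 := Algebra.norm_ne_zero_iff.mpr hz0
  refine ⟨(PadicBase.toPadic hp (Algebra.norm (PadicBase F p hp) z)).valuation, ?_⟩
  have h := norm_algebraMap_norm_base_eq hp M z
  rw [PadicBase.norm_algebraMap_closure, PadicBase.norm_eq_norm_p_zpow hp _ hN0] at h
  rw [← h, PadicBase.norm_natCast_closure hp]

end Norms

/-! ### §2 The value group is cyclic: uniformisers -/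

section Uniformizer

variable (M : IntermediateField (PadicBase F p hp) (NormedAlgClosure F))
  [FiniteDimensional (PadicBase F p hp) M]

/-- **A finite extension of `ℚ_p` inside `F̄` has a uniformiser**: there is `ϖ ∈ M` with
`0 < ‖ϖ‖ < 1` such that every `x ∈ M`, `x ≠ 0`, has `‖x‖ = ‖ϖ‖ ^ k` for some `k ∈ ℤ` (the value
group of `M` is a subgroup of the cyclic group `‖p‖^{(1/[M:K₀])ℤ}`, hence cyclic; `ϖ` realises its
least positive exponent). [cite: SerreLocalFields1979, Ch. II §2–§3] [cite: LangANT1994, Ch. II §4] -/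
theorem exists_uniformizer :
    ∃ ϖ ∈ M, ϖ ≠ 0 ∧ ‖ϖ‖ < 1 ∧ ∀ x ∈ M, x ≠ 0 → ∃ k : ℤ, ‖x‖ = ‖ϖ‖ ^ k := by
  classical
  have hprime : p.Prime := Fact.out
  set n : ℕ := finrank (PadicBase F p hp) M with hn
  set q : ℝ := ‖(p : NormedAlgClosure F)‖ with hq
  have hp0 : (p : NormedAlgClosure F) ≠ 0 := Nat.cast_ne_zero.mpr hprime.ne_zero
  have hq0 : 0 < q := norm_pos_iff.mpr hp0
  have hq1 : q < 1 := by rw [hq, PadicBase.norm_natCast_closure hp]; exact PadicBase.norm_p_lt_one hp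
  have hn0 : 0 < n := finrank_pos
  -- the exponents `d > 0` realised as `‖x‖^n = q^d`
  have hP : ∃ d : ℕ, 0 < d ∧ ∃ x ∈ M, x ≠ 0 ∧ ‖x‖ ^ n = q ^ (d : ℤ) :=
    ⟨n, hn0, (p : NormedAlgClosure F), by exact_mod_cast (_root_.natCast_mem M p), hp0,
      by rw [hq, zpow_natCast]⟩
  set d₀ : ℕ := Nat.find hP with hd₀
  have hspec := Nat.find_spec hP
  rw [← hd₀] at hspec
  obtain ⟨hd₀pos, ϖ, hϖM, hϖ0, hϖn⟩ := hspec
  have hmin : ∀ d : ℕ, d < d₀ → ¬ (0 < d ∧ ∃ x ∈ M, x ≠ 0 ∧ ‖x‖ ^ n = q ^ (d : ℤ)) :=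
    fun d hd => Nat.find_min hP hd
  have hϖpos : 0 < ‖ϖ‖ := norm_pos_iff.mpr hϖ0
  have hϖ1 : ‖ϖ‖ < 1 := by
    by_contra hge
    rw [not_lt] at hge
    have h1 : (1 : ℝ) ≤ ‖ϖ‖ ^ n := one_le_pow₀ hge
    rw [hϖn, zpow_natCast] at h1
    exact absurd (pow_lt_one₀ hq0.le hq1 hd₀pos.ne') (not_lt.mpr h1)
  refine ⟨ϖ, hϖM, hϖ0, hϖ1, fun x hx hx0 => ?_⟩
  obtain ⟨k, hk⟩ := exists_norm_pow_finrank_eq_zpow hp M hx hx0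
  -- division with remainder `k = d₀ a + r`
  set a : ℤ := k / d₀ with ha
  set r : ℤ := k % d₀ with hr
  have hd₀Z : (d₀ : ℤ) ≠ 0 := by exact_mod_cast hd₀pos.ne'
  have hkar : k = d₀ * a + r := by rw [ha, hr]; exact (Int.mul_ediv_add_emod k d₀).symm
  have hr0 : 0 ≤ r := Int.emod_nonneg k hd₀Z
  have hrd : r < d₀ := Int.emod_lt_of_pos k (by exact_mod_cast hd₀pos)
  -- `y = x ϖ^{-a}` has `‖y‖^n = q^r`
  set y : NormedAlgClosure F := x * ϖ ^ (-a) with hy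
  have hyM : y ∈ M := mul_mem hx (zpow_mem hϖM _)
  have hy0 : y ≠ 0 := mul_ne_zero hx0 (zpow_ne_zero _ hϖ0)
  have hyn : ‖y‖ ^ n = q ^ r := by
    have h1 : ‖y‖ ^ n = ‖x‖ ^ n * (‖ϖ‖ ^ n) ^ (-a) := by
      rw [hy, norm_mul, norm_zpow, mul_pow, ← zpow_natCast (‖ϖ‖ ^ (-a)) n, ← zpow_mul,
        mul_comm (-a) (n : ℤ), zpow_mul, zpow_natCast]
    rw [h1, hn, hk, ← hn, hϖn, ← zpow_mul, ← zpow_add₀ hq0.ne', hkar]; ring_nf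
  -- the remainder vanishes by minimality of `d₀`
  have hr00 : r = 0 := by
    by_contra hrne
    have hrpos : 0 < r := lt_of_le_of_ne hr0 (Ne.symm hrne)
    have hlt : r.toNat < d₀ := by
      have : (r.toNat : ℤ) < d₀ := by rw [Int.toNat_of_nonneg hr0]; exact hrd
      exact_mod_cast this
    refine hmin r.toNat hlt ⟨by omega, y, hyM, hy0, ?_⟩
    rw [hyn, Int.toNat_of_nonneg hr0]
  rw [hr00, zpow_zero] at hyn
  have hy1 : ‖y‖ = 1 := (pow_eq_one_iff_of_nonneg (norm_nonneg y) hn0.ne').mp hyn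
  refine ⟨a, ?_⟩
  have : x = y * ϖ ^ a := by
    rw [hy, mul_assoc, ← zpow_add₀ hϖ0, neg_add_cancel, zpow_zero, mul_one]
  rw [this, norm_mul, hy1, one_mul, norm_zpow]

variable {M}

omit [FiniteDimensional (PadicBase F p hp) M] in
/-- **Discreteness**: with a uniformiser `ϖ` of `M`, every `x ∈ M` with `‖x‖ < 1` has `‖x‖ ≤ ‖ϖ‖`.
[cite: SerreLocalFields1979, Ch. II §2] -/
theorem norm_le_norm_uniformizer_of_norm_lt_one {ϖ : NormedAlgClosure F} (hϖ0 : ϖ ≠ 0) (hϖ1 : ‖ϖ‖ < 1)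
    (hval : ∀ x ∈ M, x ≠ 0 → ∃ k : ℤ, ‖x‖ = ‖ϖ‖ ^ k)
    {x : NormedAlgClosure F} (hx : x ∈ M) (hx1 : ‖x‖ < 1) : ‖x‖ ≤ ‖ϖ‖ := by
  by_cases hx0 : x = 0
  · rw [hx0, norm_zero]; exact norm_nonneg _
  obtain ⟨k, hk⟩ := hval x hx hx0
  have hϖpos : 0 < ‖ϖ‖ := norm_pos_iff.mpr hϖ0
  have hk1 : 1 ≤ k := by
    by_contra hlt
    rw [not_le] at hlt
    have : (1 : ℝ) ≤ ‖ϖ‖ ^ k := one_le_zpow_of_nonpos₀ hϖpos hϖ1.le (by omega)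
    rw [← hk] at this
    exact absurd hx1 (not_lt.mpr this)
  rw [hk]
  calc ‖ϖ‖ ^ k ≤ ‖ϖ‖ ^ (1 : ℤ) := zpow_le_zpow_right_of_le_one₀ hϖpos hϖ1.le hk1
    _ = ‖ϖ‖ := zpow_one _

omit [FiniteDimensional (PadicBase F p hp) M] in
/-- With a uniformiser `ϖ` of `M`: every `x ∈ M`, `x ≠ 0`, `‖x‖ ≤ 1` has `‖x‖ = ‖ϖ‖ ^ k` with `k ∈ ℕ`.
[cite: SerreLocalFields1979, Ch. II §2] -/
theorem exists_norm_eq_uniformizer_pow_of_norm_le_one {ϖ : NormedAlgClosure F} (hϖ0 : ϖ ≠ 0)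
    (hϖ1 : ‖ϖ‖ < 1) (hval : ∀ x ∈ M, x ≠ 0 → ∃ k : ℤ, ‖x‖ = ‖ϖ‖ ^ k)
    {x : NormedAlgClosure F} (hx : x ∈ M) (hx0 : x ≠ 0) (hx1 : ‖x‖ ≤ 1) :
    ∃ k : ℕ, ‖x‖ = ‖ϖ‖ ^ k := by
  obtain ⟨k, hk⟩ := hval x hx hx0
  have hϖpos : 0 < ‖ϖ‖ := norm_pos_iff.mpr hϖ0
  have hk0 : 0 ≤ k := by
    by_contra hlt
    rw [not_le] at hlt
    have : (1 : ℝ) < ‖ϖ‖ ^ k := one_lt_zpow_of_neg₀ hϖpos hϖ1 hlt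
    rw [← hk] at this
    exact absurd hx1 (not_le.mpr this)
  refine ⟨k.toNat, ?_⟩
  rw [hk, ← zpow_natCast, Int.toNat_of_nonneg hk0]

omit [CharZero F] [FiniteDimensional (PadicBase F p hp) M] in
/-- With a uniformiser `ϖ`: `‖x‖ = ‖ϖ‖ ^ k` (`k ∈ ℤ`) ⇒ `x ϖ^{-k}` has norm `1` (`x = u ϖ^k` with `u` a
unit). [cite: SerreLocalFields1979, Ch. II §2] -/
theorem norm_mul_uniformizer_zpow_neg {ϖ : NormedAlgClosure F} (hϖ0 : ϖ ≠ 0)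
    {x : NormedAlgClosure F} {k : ℤ} (hk : ‖x‖ = ‖ϖ‖ ^ k) : ‖x * ϖ ^ (-k)‖ = 1 := by
  have hϖpos : 0 < ‖ϖ‖ := norm_pos_iff.mpr hϖ0
  rw [norm_mul, norm_zpow, hk, ← zpow_add₀ hϖpos.ne', add_neg_cancel, zpow_zero]

end Uniformizer

/-! ### §3 The ramification index divides the degree -/

section Ramification

variable (B : IntermediateField (PadicBase F p hp) (NormedAlgClosure F))
  (L : IntermediateField B (NormedAlgClosure F)) [FiniteDimensional B L]

/-- **The ramification index divides the degree.** Let `K₀ ⊆ B ⊆ L ⊆ F̄` with `L/B` finite, let the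
value group of `B` be `‖π‖^ℤ` (`π ∈ B`), and let `ϖ ∈ L` with `0 < ‖ϖ‖ < 1` and `‖π‖ = ‖ϖ‖ ^ e`. Then
`e ∣ [L : B]`: indeed `‖N_{L/B}(ϖ)‖ = ‖ϖ‖ ^ [L:B]` (isometric conjugates) lies in `‖π‖^ℤ = ‖ϖ‖^{eℤ}`.
(With `ϖ` a uniformiser of `L`, `e` is the ramification index of `L/B`.)
[cite: SerreLocalFields1979, Ch. II §2 Cor. 4, Ch. I §4 Prop. 10] [cite: LangANT1994, Ch. II §4] -/
theorem ramificationIndex_dvd_finrank {π : NormedAlgClosure F}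
    (hvalB : ∀ y ∈ B, y ≠ 0 → ∃ j : ℤ, ‖y‖ = ‖π‖ ^ j)
    {ϖ : NormedAlgClosure F} (hϖL : ϖ ∈ L) (hϖ0 : ϖ ≠ 0) (hϖ1 : ‖ϖ‖ < 1)
    {e : ℕ} (he : ‖π‖ = ‖ϖ‖ ^ e) : e ∣ finrank B L := by
  have hϖpos : 0 < ‖ϖ‖ := norm_pos_iff.mpr hϖ0
  haveI : Module.Free B L := Module.Free.of_divisionRing B L
  set z : L := ⟨ϖ, hϖL⟩ with hz
  have hz0 : z ≠ 0 := fun h => hϖ0 (by rw [hz] at h; exact congrArg Subtype.val h)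
  have hN0 : Algebra.norm B z ≠ 0 := Algebra.norm_ne_zero_iff.mpr hz0
  have hNE0 : ((Algebra.norm B z : B) : NormedAlgClosure F) ≠ 0 := fun h => hN0 (Subtype.ext h)
  obtain ⟨j, hj⟩ := hvalB _ (Algebra.norm B z).2 hNE0
  have hnorm := norm_norm_eq hp B L z
  -- `‖ϖ‖^{[L:B]} = ‖ϖ‖^{e j}`
  have heq : ‖ϖ‖ ^ ((finrank B L : ℕ) : ℤ) = ‖ϖ‖ ^ ((e : ℤ) * j) := by
    rw [zpow_natCast, ← hnorm, hj, he, ← zpow_natCast, ← zpow_mul]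
  have hinj := zpow_right_injective₀ hϖpos hϖ1.ne heq
  exact Int.natCast_dvd_natCast.mp ⟨j, hinj⟩

/-- **`p ∤ [L : B] ⇒ p ∤ e`** (the ramification index of a prime-to-`p` extension is prime to `p`).
[cite: SerreLocalFields1979, Ch. II §2] [cite: LangANT1994, Ch. II §5] -/
theorem not_dvd_ramificationIndex_of_not_dvd_finrank {π : NormedAlgClosure F}
    (hvalB : ∀ y ∈ B, y ≠ 0 → ∃ j : ℤ, ‖y‖ = ‖π‖ ^ j)
    {ϖ : NormedAlgClosure F} (hϖL : ϖ ∈ L) (hϖ0 : ϖ ≠ 0) (hϖ1 : ‖ϖ‖ < 1)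
    {e : ℕ} (he : ‖π‖ = ‖ϖ‖ ^ e) (hd : ¬ p ∣ finrank B L) : ¬ p ∣ e :=
  fun h => hd (h.trans (ramificationIndex_dvd_finrank hp B L hvalB hϖL hϖ0 hϖ1 he))

end Ramification

end TateAlmostEtale

end Literature.NumberTheory.PAdicHodge

end
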